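import Mathlib
import HarnessLib
import Literature.Geometry.DiscreteGeometry.KissingRigidity
import Summits.AtomisticToContinuum.Crystallization.Theorems.PricedLinkCensusSoftFourRingsRigCell

/-!
# Soft four-rings, metric half by certified numerics (6): the two models and the data format

Route `PricedLinkCensus`, sub-problem `Crystallization`, item `SoftFourRings`
(stmt-AtomisticToContinuum-14234).

* `fccModel`, `hcpModel`: the labelled cuboctahedron / anticuboctahedron (tables `fccTab`,
  `hcpTab` and contact relations `fccAdj`, `hcpAdj` of `Literature/…/KissingRigidity`), with the
  frame triangle, the free point and the eight construction steps used by the certificates.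
* The certificate format: a cell is a byte string (base64 in the source), bytes carry naturals
  in LEB128; `decodeCell` parses it into a `Cell` (`…RigCell`).  Parsing is untrusted glue: the
  soundness theorem only ever speaks about the parsed cell.
* `coversChart`: the parsed cells of one chart chain from `y ≤ −1` to `y ≥ 1`.
-/

namespace Summit.AtomisticToContinuum.Crystallization.Theorems

namespace Rig

open Literature.Geometry.DiscreteGeometry
open Literature.Analysis.ValidatedNumerics.NumericsMP

/-! ### The two models -/

/-- The FCC (cuboctahedron) model: frame `(0, 4, 8)`, free point `9`. -/
def fccModel : Model where
  bond := fun i j => decide (fccAdj i j)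
  r0 := 0
  r1 := 4
  r2 := 8
  free := 9
  steps := [⟨5, 0, 9, true⟩, ⟨1, 4, 5, true⟩, ⟨2, 8, 9, false⟩, ⟨10, 1, 4, false⟩, ⟨6, 2, 8, true⟩,
    ⟨11, 1, 5, true⟩, ⟨7, 2, 9, false⟩, ⟨3, 6, 10, true⟩]
  tab := fccTab
  normSq := 2

/-- The HCP (anticuboctahedron) model: frame `(6, 7, 8)` (the upper cap), free point `4`. -/
def hcpModel : Model where
  bond := fun i j => decide (hcpAdj i j)
  r0 := 6
  r1 := 7
  r2 := 8
  free := 4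
  steps := [⟨2, 4, 6, false⟩, ⟨0, 2, 7, false⟩, ⟨5, 0, 7, false⟩, ⟨9, 2, 4, true⟩, ⟨10, 0, 5, false⟩,
    ⟨3, 5, 8, false⟩, ⟨1, 3, 8, false⟩, ⟨11, 1, 3, true⟩]
  tab := hcpTab
  normSq := 18

/-! ### Decoding -/

/-- Value of a base64 character (`none` for padding / junk). -/
def b64val (c : Char) : Option ℕ :=
  let n := c.toNat
  if 65 ≤ n ∧ n ≤ 90 then some (n - 65)
  else if 97 ≤ n ∧ n ≤ 122 then some (n - 97 + 26)
  else if 48 ≤ n ∧ n ≤ 57 then some (n - 48 + 52)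
  else if n = 43 then some 62
  else if n = 47 then some 63
  else none

/-- Base64 text to bytes (trailing partial groups handled; junk characters skipped). -/
def decodeB64 (s : String) : Array ℕ :=
  let vals := s.toList.filterMap b64val
  let rec go : List ℕ → Array ℕ → Array ℕ
    | a :: b :: c :: d :: rest, acc =>
      go rest ((acc.push ((a * 4 + b / 16) % 256)).push ((b * 16 + c / 4) % 256) |>.push ((c * 64 + d) % 256))
    | [a, b, c], acc => (acc.push ((a * 4 + b / 16) % 256)).push ((b * 16 + c / 4) % 256)
    | [a, b], acc => acc.push ((a * 4 + b / 16) % 256)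
    | _, acc => acc
  go vals #[]

/-- LEB128 bytes to naturals. -/
def varints (bytes : Array ℕ) : Array ℕ :=
  let rec go (i : ℕ) (shift cur : ℕ) (acc : Array ℕ) (fuel : ℕ) : Array ℕ :=
    match fuel with
    | 0 => acc
    | fuel + 1 =>
      if h : i < bytes.size then
        let b := bytes[i]
        let cur' := cur + (b % 128) * 2 ^ shift
        if b < 128 then go (i + 1) 0 0 (acc.push cur') fuel
        else go (i + 1) (shift + 7) cur' acc fuel
      else acc
  go 0 0 0 #[] bytes.size

/-- Zigzag decoding of a signed integer. -/
def unzz (n : ℕ) : ℤ := if n % 2 = 0 then (n / 2 : ℕ) else -(((n + 1) / 2 : ℕ) : ℤ)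

/-- A cursor over the decoded naturals. -/
structure Cur where
  /-- data -/
  d : Array ℕ
  /-- position -/
  i : ℕ

/-- Read one natural (junk `0` past the end). -/
def Cur.next (c : Cur) : ℕ × Cur := (c.d.getD c.i 0, ⟨c.d, c.i + 1⟩)

/-- Is the cursor exhausted? -/
def Cur.done (c : Cur) : Bool := c.d.size ≤ c.i

/-- Read `n` terms `(j, Y)`. -/
def readTerms : ℕ → Cur → List (ℕ × ℕ) × Cur
  | 0, c => ([], c)
  | n + 1, c =>
    let (j, c) := c.next
    let (y, c) := c.next
    let (ts, c) := readTerms n c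
    ((j, y) :: ts, c)

/-- Read a length-prefixed term list. -/
def readTermList (c : Cur) : List (ℕ × ℕ) × Cur :=
  let (n, c) := c.next
  readTerms n c

/-- Read a certificate `(2^kk, terms)`. -/
def readCert (c : Cur) : Cert × Cur :=
  let (kk, c) := c.next
  let (ts, c) := readTermList c
  ((2 ^ kk, ts), c)

/-- Read `n` certificates. -/
def readCerts : ℕ → Cur → List Cert × Cur
  | 0, c => ([], c)
  | n + 1, c =>
    let (ct, c) := readCert c
    let (cts, c) := readCerts n c
    (ct :: cts, c)

/-- Convert with range check. -/
def toFin12 (n : ℕ) : Fin 12 := ⟨n % 12, Nat.mod_lt _ (by norm_num)⟩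
/-- Convert with range check. -/
def toFin3 (n : ℕ) : Fin 3 := ⟨n % 3, Nat.mod_lt _ (by norm_num)⟩

/-- Read the instruction stream (fuel-bounded). -/
def readInstrs : ℕ → Cur → List Instr
  | 0, _ => []
  | fuel + 1, c =>
    if c.done then []
    else
      let (op, c) := c.next
      if op = 0 then
        let (v, c) := c.next
        let (k, c) := c.next
        let (up, c) := c.next
        let (ct, c) := readCert c
        Instr.bound (toFin12 v) (toFin3 k) (up = 1) ct :: readInstrs fuel c
      else if op = 1 then
        let (ts, c) := readTermList c
        Instr.prune ts :: readInstrs fuel c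
      else if op = 2 then
        let (ts, c) := readTermList c
        let (n, c) := c.next
        Instr.place ts n :: readInstrs fuel c
      else if op = 3 then
        let (qw, c) := c.next
        let (qx, c) := c.next
        let (qy, c) := c.next
        let (qz, c) := c.next
        let (rf, c) := c.next
        let (cts, c) := readCerts 72 c
        Instr.objective (unzz qw) (unzz qx) (unzz qy) (unzz qz) (rf = 1) cts :: readInstrs fuel c
      else []

/-- **Decode a cell** from its base64 text. -/
def decodeCell (s : String) : Cell :=
  let d := varints (decodeB64 s)
  let c : Cur := ⟨d, 0⟩
  let (xp, c) := c.next
  let (tlo, c) := c.next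
  let (thi, c) := c.next
  { xpos := (xp = 1), tlo := unzz tlo, thi := unzz thi, instrs := readInstrs d.size c }

/-! ### Coverage of the parameter range -/

/-- The cells of chart `xpos`, in the given order, chain from `tlo ≤ −S` to `thi ≥ S`
(consecutive cells overlap or touch). -/
def coversChart (cells : List Cell) (xpos : Bool) : Bool :=
  let cs := cells.filter fun c => c.xpos == xpos
  match cs with
  | [] => false
  | c0 :: rest =>
    decide (c0.tlo ≤ -(SC : ℤ)) &&
      (let last := rest.foldl (fun (acc : Option ℤ) c =>
          match acc with
          | none => none
          | some hi => if c.tlo ≤ hi then some (max hi c.thi) else none) (some c0.thi)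
       match last with
       | none => false
       | some hi => decide ((SC : ℤ) ≤ hi))

/-- **The full check of one pattern**: both charts covered and every cell certified. -/
def checkAll (m : Model) (cells : List Cell) : Bool :=
  coversChart cells true && coversChart cells false && cells.all (runCell m)

end Rig

end Summit.AtomisticToContinuum.Crystallization.Theorems
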